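import Literature.Combinatorics.SimpleGraph.RandomLiftExistence
import Summits.PneNP.PneNP.Theorems.ExpanderLinearGeneratorsGraphTseitin
import Summits.PneNP.PneNP.Theorems.ExpanderLinearGeneratorsLinearGeneratorModPFregeHardCalibration

/-!
# The ladder rungs are exercised by linear-size instances from locality `ℓ = 9` on
# (items stmt-PneNP-11443 / stmt-PneNP-11442, helper file)

Route `PneNP/ExpanderLinearGenerators`, cruxes `LinearGeneratorDepthFregeHard` (stmt-PneNP-11443,
Krajíček's Problem 19.4.5 in universal-expander form) and `ExpansionForcesDepthFregeSize`
(stmt-PneNP-11442, the expansion-scale law).  Both rungs quantify over `ℓ`-sparse systems `E` over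
`𝔽₂` whose row supports form an `(r, 3ℓ/4)`-boundary expander and which are unsolvable.  The
kernel-checked vacuity floors of the route show that for `ℓ ≤ 7` no such system exists once
`r ≥ 1 + ℓ + ℓ²`, and that for `ℓ = 8` every such system has `≥ 2^(⌊r⌋/8 - 1)` rows, so the rungs
hold there for trivial reasons.  This file proves that the threshold `ℓ = 9` is EXACT: for every
`ℓ ≥ 9` and every fibre size `a ≥ 1` there is an `ℓ`-sparse unsolvable system with
`m = (ℓ+1)·a` rows and `n = ℓ(ℓ+1)a/2` variables whose supports form an
`(a / (128·(16(ℓ+1))⁸), 3ℓ/4)`-boundary expander — expansion at LINEAR scale in the size of the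
system (`exists_liftTseitin_system`).  The systems are the Tseitin (odd-charge) systems of
`ℓ`-regular graphs all of whose vertex sets `U` of size `≤ a/(128·(16(ℓ+1))⁸)` span at most
`(1 + 1/8)|U|` edges; such graphs exist among the `a`-lifts of `K_{ℓ+1}` by the first-moment
count `Literature.Combinatorics.SimpleGraph.exists_sparse_lift` (Amit–Linial random lifts).  For a
vertex set `U` the unique-neighbour variables of its rows are the edges leaving `U`, which number
`ℓ|U| - 2e(U) ≥ (ℓ - 9/4)|U| ≥ (3ℓ/4)|U|` exactly when `ℓ ≥ 9` (the graph-Tseitin bookkeeping is in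
`ExpanderLinearGeneratorsGraphTseitin.lean`).

Consequences recorded against the route decls:
* `expansionForcesDepthFregeSize_instances_at_scale` — for `ℓ ≥ 9` and EVERY scale `r` the
  hypotheses of crux 2 are met by a system with `m ≤ C_ℓ · max r 1` rows: the trivial bound
  `proofSize ≥ m` is linear in `r`, so the rung's `2^(r^ε)` is genuine content there;
* `linearGeneratorDepthFregeHard_instances` — for `ℓ ≥ 9` and every `δ > 0` the hypotheses of
  crux 3 are met on EVERY large number `n` of variables by a system with `m ≤ n` rows
  (padding with unused variables, `exists_padded_system`);
* `linearGeneratorDepthFregeHard_instances_with_proofs` — … together with an actual depth-`d`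
  `textbookFrege` proof of the target for every `d ≥ 30` (refutation completeness,
  `exists_isDepthProofOf_neg_ofCNF_of_le`), so under the crux these existing proofs have size
  `≥ 2^(n^ε)` (`linearGeneratorDepthFregeHard_lift_content`): from `ℓ = 9`, `d = 30` on the crux
  is a superpolynomial lower bound for depth-`d` `textbookFrege` on an existing explicit-size
  family, not an implication with an unsatisfiable antecedent;
  `linearGeneratorModPFregeHard_lift_content` records the same for the `AC⁰[p]` rung
  (stmt-PneNP-11444, `exists_isModDepthProofOf_sumEncoding`).
The instances have column weight `2` (graph Tseitin), the case in which the rungs are theorems in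
print (Galesi–Itsykson–Riazanov–Sofronova 2023 with Håstad 2020, via treewidth `≥ Ω(r)`); a
refutation of either rung must therefore use column weight `≥ 3`.  Sibling instance files:
EXPLICIT instances — the Tseitin systems of Margulis's large-girth Cayley graphs of `SL₂(ℤ/N)`, for
the one locality `ℓ = 16` and expansion scale `n^(1/200)` (`δ ≥ 199/200`) — in
`…LinearGeneratorDepthFregeHardNonvacuous.lean`, and random `8k`-sparse MATRICES (Krajíček's
Thm. 13.3.1, locality `ℓ = 8k` depending on `δ`, `k ≥ 2/δ`) in
`…LinearGeneratorModPFregeHardRandomInstances.lean`.  The present file is the one covering EVERY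
locality `ℓ ≥ 9` together with EVERY `δ ∈ (0,1)` (expansion at linear scale, `m ≤ n` rows), which is
what makes the locality threshold `ℓ = 9` of the vacuity floors exact.

References: J. Krajíček, *Proof Complexity* (CUP 2019), §13.3 (expanders), Problem 19.4.5
[KrajicekProofComplexity2019]; E. Ben-Sasson, A. Wigderson, J. ACM 48 (2001), §5–6 (boundary
expansion) [BenSassonWigderson2001]; A. Amit, N. Linial, Combinatorica 22 (2002) (random lifts);
G. S. Tseitin (1968) / A. Urquhart, J. ACM 34 (1987) (Tseitin systems of graphs) [folklore].
-/

set_option linter.dupNamespace false -- `Summit.PneNP.PneNP.…`: summit = sub-problem (D-0017)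

namespace Summit.PneNP.PneNP.Theorems

open Literature.Computability.Complexity Literature.Computability.MetaComplexity
open Literature.ModelTheory.FiniteModelTheory.ConnerydGhannanePang (IsSparse)
open Literature.Combinatorics.SimpleGraph (liftGraph exists_sparse_lift isRegularOfDegree_liftGraph)

/-! ### Instances: Tseitin systems of sparse lifts of `K_{ℓ+1}` -/

/-- **Linear-size expanding unsolvable `ℓ`-sparse systems exist for every `ℓ ≥ 9`.** For
`ℓ ≥ 9` and `a ≥ 1` there is a system of `m = (ℓ+1)·a` equations over `𝔽₂` in `n` unknowns,
`2n = ℓ·m`, every row of support exactly `ℓ`, unsolvable, whose row supports form an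
`(a / (128·(16(ℓ+1))⁸), 3ℓ/4)`-boundary expander: the odd-charge Tseitin system of an
`ℓ`-regular `a`-lift of `K_{ℓ+1}` all of whose vertex sets of size `≤ a/(128·(16(ℓ+1))⁸)` span
at most `(1 + 1/8)`-times as many edges (`exists_sparse_lift`, first-moment method over random
lifts). [Krajíček 2019, §13.3 and Thm. 13.3.1 (existence of expanders, there for random
matrices); Amit–Linial 2002 (random lifts)] [folklore] -/
theorem exists_liftTseitin_system {ℓ : ℕ} (hℓ : 9 ≤ ℓ) {a : ℕ} (ha : 1 ≤ a) :
    ∃ (n : ℕ) (E : Fin ((ℓ + 1) * a) → LinEqMod 2 n),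
      2 * n = ℓ * ((ℓ + 1) * a) ∧
      (∀ i, (E i).supp.card = ℓ) ∧
      IsBoundaryExpander (fun i => (E i).supp.map Fin.valEmbedding)
        ((a / (128 * (16 * (ℓ + 1)) ^ 8) : ℕ) : ℝ) (3 / 4 * ℓ) ∧
      ¬ SystemSat E Finset.univ := by
  obtain ⟨π, hπ⟩ := exists_sparse_lift (B := (⊤ : SimpleGraph (Fin (ℓ + 1)))) (a := a) (q := 8)
    (by norm_num) (by simp) ha
  have hsp : IsSparse (liftGraph π) (a / (128 * (16 * (ℓ + 1)) ^ 8)) (1 / 8) := by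
    convert hπ using 2 <;> norm_num [Fintype.card_fin]
  have hreg : (liftGraph π).IsRegularOfDegree ℓ := by
    have h := isRegularOfDegree_liftGraph (B := (⊤ : SimpleGraph (Fin (ℓ + 1))))
      SimpleGraph.IsRegularOfDegree.top π
    simpa only [Fintype.card_fin, Nat.add_sub_cancel] using h
  set G := liftGraph π with hG
  let ev : Fin ((ℓ + 1) * a) ≃ Fin (ℓ + 1) × Fin a := finProdFinEquiv.symm
  let ee : Fin G.edgeFinset.card ≃ G.edgeFinset := G.edgeFinset.equivFin.symm
  let v₀ : Fin (ℓ + 1) × Fin a := (0, ⟨0, ha⟩)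
  let χ : Fin (ℓ + 1) × Fin a → ZMod 2 := fun v => if v = v₀ then 1 else 0
  let E : Fin ((ℓ + 1) * a) → LinEqMod 2 G.edgeFinset.card := fun i =>
    (fun j => if ev i ∈ ((ee j : G.edgeFinset) : Sym2 (Fin (ℓ + 1) × Fin a)) then 1 else 0,
      χ (ev i))
  have h1 : ∀ i j, (E i).1 j =
      if ev i ∈ ((ee j : G.edgeFinset) : Sym2 (Fin (ℓ + 1) × Fin a)) then 1 else 0 :=
    fun _ _ => rfl
  refine ⟨G.edgeFinset.card, E, ?_, ?_, ?_, ?_⟩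
  · have h := G.sum_degrees_eq_twice_card_edges
    rw [Finset.sum_congr rfl fun v _ => hreg.degree_eq v, Finset.sum_const, smul_eq_mul,
      Finset.card_univ, Fintype.card_prod, Fintype.card_fin, Fintype.card_fin] at h
    rw [← h]
    ring
  · intro i
    rw [card_supp_of_incidence h1, hreg.degree_eq]
  · exact isBoundaryExpander_of_isSparse h1 hreg hℓ hsp le_rfl
  · refine not_systemSat_of_incidence (χ := χ) h1 (fun _ => rfl) ?_
    show ∑ v, (if v = v₀ then (1 : ZMod 2) else 0) = 1
    simp

/-- **Crux 2 (`ExpansionForcesDepthFregeSize`, stmt-PneNP-11442) is exercised at every scale by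
linear-size systems.** For `ℓ ≥ 9` and every `r` there is an `ℓ`-sparse unsolvable system whose
supports form an `(r, 3ℓ/4)`-boundary expander and which has only
`m ≤ 256(ℓ+1)(16(ℓ+1))⁸ · max r 1` rows (and `2n = ℓm` variables).  So from `ℓ = 9` on the
trivial estimate `proofSize ≥ m` is linear in `r` and the rung's `2^(r^ε)` is not automatic
(contrast `ℓ = 8`, where `m ≥ 2^(⌊r⌋/8-1)` is forced, and `ℓ ≤ 7`, where no instance exists).
[Krajíček 2019, §13.3–13.4; Ben-Sasson–Wigderson 2001, §6] [folklore] -/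
theorem expansionForcesDepthFregeSize_instances_at_scale {ℓ : ℕ} (hℓ : 9 ≤ ℓ) (r : ℝ) :
    ∃ (n m : ℕ) (E : Fin m → LinEqMod 2 n),
      (m : ℝ) ≤ 256 * (ℓ + 1) * (16 * (ℓ + 1)) ^ 8 * max r 1 ∧ 2 * n = ℓ * m ∧
      (∀ i, (E i).supp.card ≤ ℓ) ∧
      IsBoundaryExpander (fun i => (E i).supp.map Fin.valEmbedding) r (3 / 4 * ℓ) ∧
      ¬ SystemSat E Finset.univ := by
  set K : ℕ := 128 * (16 * (ℓ + 1)) ^ 8 with hK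
  have hKpos : 0 < K := by positivity
  set t : ℕ := ⌈max r 1⌉₊ with ht
  have hmax : (1 : ℝ) ≤ max r 1 := le_max_right r 1
  have ht1 : 1 ≤ t := Nat.one_le_ceil_iff.2 (lt_of_lt_of_le one_pos hmax)
  have ha : 1 ≤ K * t := Nat.one_le_iff_ne_zero.2 (Nat.mul_ne_zero hKpos.ne' (by omega))
  obtain ⟨n, E, hn, hsupp, hexp, hunsat⟩ := exists_liftTseitin_system hℓ ha
  have hdiv : K * t / K = t := Nat.mul_div_cancel_left t hKpos
  rw [← hK, hdiv] at hexp
  refine ⟨n, (ℓ + 1) * (K * t), E, ?_, hn, fun i => (hsupp i).le, ?_, hunsat⟩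
  · have htle : (t : ℝ) ≤ max r 1 + 1 := (Nat.ceil_lt_add_one (zero_le_one.trans hmax)).le
    have ht2 : (t : ℝ) ≤ 2 * max r 1 := by linarith
    have hKR : (K : ℝ) = 128 * (16 * (ℓ + 1)) ^ 8 := by rw [hK]; push_cast; ring
    have hcoef : (0 : ℝ) ≤ (ℓ + 1) * K := by positivity
    calc (((ℓ + 1) * (K * t) : ℕ) : ℝ) = (ℓ + 1) * K * t := by push_cast; ring
      _ ≤ (ℓ + 1) * K * (2 * max r 1) := mul_le_mul_of_nonneg_left ht2 hcoef
      _ = 256 * (ℓ + 1) * (16 * (ℓ + 1)) ^ 8 * max r 1 := by rw [hKR]; ring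
  · refine hexp.mono ?_
    calc r ≤ max r 1 := le_max_left r 1
      _ ≤ t := Nat.le_ceil _

/-! ### Padding, and instances on every large number of variables -/

/-- **Padding a system with unused variables** changes neither the row supports, read as sets of
natural numbers, nor their sizes, and keeps it unsolvable. [folklore] -/
theorem exists_padded_system {m n₀ n : ℕ} (hn : n₀ ≤ n) (E : Fin m → LinEqMod 2 n₀) :
    ∃ E' : Fin m → LinEqMod 2 n,
      (∀ i, (E' i).supp.card = (E i).supp.card) ∧
      (∀ i, (E' i).supp.map Fin.valEmbedding = (E i).supp.map Fin.valEmbedding) ∧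
      (SystemSat E' Finset.univ → SystemSat E Finset.univ) := by
  let E' : Fin m → LinEqMod 2 n := fun i =>
    (fun j => if h : (j : ℕ) < n₀ then (E i).1 ⟨j, h⟩ else 0, (E i).2)
  have hE₁ : ∀ i (j₀ : Fin n₀), (E' i).1 (Fin.castLE hn j₀) = (E i).1 j₀ := by
    intro i j₀
    have hlt : ((Fin.castLE hn j₀ : Fin n) : ℕ) < n₀ := by simp
    show (if h : ((Fin.castLE hn j₀ : Fin n) : ℕ) < n₀ then (E i).1 ⟨_, h⟩ else 0) = _
    rw [dif_pos hlt]
    congr 1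
  have hE₂ : ∀ i (j : Fin n), ¬ ((j : ℕ) < n₀) → (E' i).1 j = 0 := by
    intro i j hj
    show (if h : ((j : Fin n) : ℕ) < n₀ then (E i).1 ⟨_, h⟩ else 0) = 0
    rw [dif_neg hj]
  have hsupp : ∀ i, (E' i).supp = (E i).supp.map (Fin.castLEEmb hn) := by
    intro i
    ext j
    simp only [LinEqMod.supp, Finset.mem_filter, Finset.mem_univ, true_and, Finset.mem_map,
      Fin.castLEEmb_apply]
    constructor
    · intro hj
      by_cases h : (j : ℕ) < n₀
      · refine ⟨⟨j, h⟩, ?_, Fin.ext (by simp)⟩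
        rwa [← hE₁ i ⟨j, h⟩, show Fin.castLE hn ⟨j, h⟩ = j from Fin.ext (by simp)]
      · exact absurd (hE₂ i j h) hj
    · rintro ⟨j₀, hj₀, rfl⟩
      rwa [hE₁]
  refine ⟨E', fun i => by rw [hsupp, Finset.card_map], fun i => ?_, ?_⟩
  · rw [hsupp, Finset.map_map]
    congr 1
  · rintro ⟨z, hz⟩
    refine ⟨fun j₀ => z (Fin.castLE hn j₀), fun i _ => ?_⟩
    have h := hz i (Finset.mem_univ i)
    change ∑ j, (E' i).1 j * z j = (E i).2 at h
    change ∑ j₀, (E i).1 j₀ * z (Fin.castLE hn j₀) = (E i).2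
    rw [← h, Finset.sum_congr rfl fun j₀ _ => by rw [← hE₁ i j₀]]
    have hsub : ∑ j ∈ (Finset.univ : Finset (Fin n₀)).map (Fin.castLEEmb hn), (E' i).1 j * z j =
        ∑ j, (E' i).1 j * z j := by
      refine Finset.sum_subset (Finset.subset_univ _) fun j _ hj => ?_
      have hj' : ¬ ((j : ℕ) < n₀) := by
        intro hlt
        exact hj (Finset.mem_map.2 ⟨⟨j, hlt⟩, Finset.mem_univ _, Fin.ext (by simp)⟩)
      rw [hE₂ i j hj', zero_mul]
    rw [← hsub, Finset.sum_map]
    simp only [Fin.castLEEmb_apply]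

/-- **The hypotheses of crux 3 (`LinearGeneratorDepthFregeHard`, stmt-PneNP-11443) are met on
every large number of variables, by systems with `m ≤ n` rows**, for every `ℓ ≥ 9` and every
`δ > 0`: the systems of `exists_liftTseitin_system` with `a = ⌊n / ℓ(ℓ+1)⌋`, padded with unused
variables — their expansion scale is linear in `n`, which eventually exceeds `n^(1-δ)`.
[Krajíček 2019, Problem 19.4.5 and Thm. 13.3.1] [folklore] -/
theorem linearGeneratorDepthFregeHard_instances {ℓ : ℕ} (hℓ : 9 ≤ ℓ) {δ : ℝ} (hδ : 0 < δ) :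
    ∃ N₀ : ℕ, ∀ n : ℕ, N₀ ≤ n → ∃ m : ℕ, m ≤ n ∧ ∃ E : Fin m → LinEqMod 2 n,
      (∀ i, (E i).supp.card ≤ ℓ) ∧
      IsBoundaryExpander (fun i => (E i).supp.map Fin.valEmbedding) ((n : ℝ) ^ (1 - δ))
        (3 / 4 * ℓ) ∧
      ¬ SystemSat E Finset.univ := by
  set K : ℕ := 128 * (16 * (ℓ + 1)) ^ 8 with hK
  have hKpos : 0 < K := by positivity
  set L : ℕ := ℓ * (ℓ + 1) with hL
  have hLpos : 0 < L := by positivity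
  -- threshold: `a ^ δ ≥ 4·K·L` for `a ≥ a₀`
  obtain ⟨a₀, ha₀⟩ : ∃ a₀ : ℕ, ∀ a : ℕ, a₀ ≤ a → (4 * (K * L) : ℝ) ≤ (a : ℝ) ^ δ := by
    have hT : Filter.Tendsto (fun a : ℕ => ((a : ℝ)) ^ δ) Filter.atTop Filter.atTop :=
      (tendsto_rpow_atTop hδ).comp tendsto_natCast_atTop_atTop
    exact Filter.eventually_atTop.1 (hT.eventually_ge_atTop _)
  refine ⟨L * max a₀ (2 * K), fun n hn => ?_⟩
  set a : ℕ := n / L with ha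
  have hAa : max a₀ (2 * K) ≤ a :=
    (Nat.le_div_iff_mul_le hLpos).2 (by rw [mul_comm]; exact hn)
  have ha₀a : a₀ ≤ a := (le_max_left _ _).trans hAa
  have haK : 2 * K ≤ a := (le_max_right _ _).trans hAa
  have ha1 : 1 ≤ a := by omega
  obtain ⟨n₀, E₀, hn₀, hsupp, hexp, hunsat⟩ := exists_liftTseitin_system hℓ ha1
  rw [← hK] at hexp
  -- sizes: `(ℓ+1)·a ≤ n₀ ≤ L·a ≤ n < L·(a+1) ≤ 2·L·a`
  have hLa : L * a ≤ n := Nat.mul_div_le n L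
  have h2n₀ : 2 * n₀ = L * a := by rw [hn₀, hL]; ring
  have hn₀La : n₀ ≤ L * a := by linarith
  have hmn₀ : (ℓ + 1) * a ≤ n₀ := by
    have h2 : 2 * ((ℓ + 1) * a) ≤ ℓ * ((ℓ + 1) * a) := Nat.mul_le_mul_right _ (by omega)
    rw [← hn₀] at h2
    exact Nat.le_of_mul_le_mul_left h2 (by norm_num)
  have hn₀n : n₀ ≤ n := hn₀La.trans hLa
  obtain ⟨E, hcardE, hmapE, hsatE⟩ := exists_padded_system hn₀n E₀
  refine ⟨(ℓ + 1) * a, hmn₀.trans hn₀n, E, fun i => (hcardE i).trans_le (hsupp i).le, ?_,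
    fun h => hunsat (hsatE h)⟩
  have hS : (fun i => (E i).supp.map Fin.valEmbedding) =
      fun i => (E₀ i).supp.map Fin.valEmbedding := funext hmapE
  rw [hS]
  refine hexp.mono ?_
  -- arithmetic: `n ^ (1-δ) = n / n ^ δ ≤ 2La / (4KL) = a/(2K) ≤ a/K - 1 ≤ ⌊a/K⌋`
  have hnlt : n < L * (a + 1) := Nat.lt_mul_div_succ n hLpos
  have han : a ≤ n := le_trans (Nat.le_mul_of_pos_left a hLpos) hLa
  have hn0 : 0 < n := lt_of_lt_of_le ha1 han
  have hnpos : (0 : ℝ) < n := by exact_mod_cast hn0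
  have hnδ : (4 * (K * L) : ℝ) ≤ (n : ℝ) ^ δ := (ha₀ a ha₀a).trans
    (Real.rpow_le_rpow (Nat.cast_nonneg a) (by exact_mod_cast han) hδ.le)
  have hnN : n ≤ 2 * (L * a) := by
    rw [mul_add, mul_one] at hnlt
    have := Nat.le_mul_of_pos_right L ha1
    linarith
  have hnR : (n : ℝ) ≤ 2 * (L * a) := by exact_mod_cast hnN
  have hKs : (a : ℝ) < K * (a / K : ℕ) + K := by
    have h := Nat.lt_mul_div_succ a hKpos
    rw [mul_add, mul_one] at h
    exact_mod_cast h
  have haKR : (2 * K : ℝ) ≤ a := by exact_mod_cast haK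
  have h3 : (a : ℝ) ≤ 2 * (K * (a / K : ℕ)) := by linarith
  have hL0 : (0 : ℝ) ≤ 2 * L := by positivity
  rw [Real.rpow_sub hnpos, Real.rpow_one, div_le_iff₀ (Real.rpow_pos_of_pos hnpos δ)]
  calc (n : ℝ) ≤ 2 * L * a := by rw [mul_assoc]; exact hnR
    _ ≤ 2 * L * (2 * (K * (a / K : ℕ))) := mul_le_mul_of_nonneg_left h3 hL0
    _ = (a / K : ℕ) * (4 * (K * L)) := by ring
    _ ≤ (a / K : ℕ) * (n : ℝ) ^ δ := mul_le_mul_of_nonneg_left hnδ (Nat.cast_nonneg _)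

/-- **Crux 3 is exercised from `ℓ = 9`, `d = 30` on.** For `ℓ ≥ 9`, `d ≥ 30`, `δ > 0` and every
large `n` there are an `ℓ`-sparse unsolvable system `E` on `n` variables with `m ≤ n` rows whose
supports form an `(n^(1-δ), 3ℓ/4)`-boundary expander AND a depth-`d` `textbookFrege` proof of
`¬ ofCNF (sumEncoding 1 E)` (refutation completeness of depth-`30` `textbookFrege`,
`exists_isDepthProofOf_neg_ofCNF_of_le`): every quantifier of the rung ranges over a nonempty
set. [Krajíček 2019, Problem 19.4.5; Krajíček 1995, §4.3–4.4] [folklore] -/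
theorem linearGeneratorDepthFregeHard_instances_with_proofs {ℓ d : ℕ} (hℓ : 9 ≤ ℓ)
    (hd : 30 ≤ d) {δ : ℝ} (hδ : 0 < δ) :
    ∃ N₀ : ℕ, ∀ n : ℕ, N₀ ≤ n → ∃ m : ℕ, m ≤ n ∧
      ∃ (E : Fin m → LinEqMod 2 n) (π : List (PropForm ℕ)),
        (∀ i, (E i).supp.card ≤ ℓ) ∧
        IsBoundaryExpander (fun i => (E i).supp.map Fin.valEmbedding) ((n : ℝ) ^ (1 - δ))
          (3 / 4 * ℓ) ∧
        ¬ SystemSat E Finset.univ ∧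
        textbookFrege.IsDepthProofOf d π (PropForm.neg (PropForm.ofCNF (sumEncoding 1 E))) := by
  obtain ⟨N₀, hN₀⟩ := linearGeneratorDepthFregeHard_instances hℓ hδ
  refine ⟨N₀, fun n hn => ?_⟩
  obtain ⟨m, hm, E, hsupp, hexp, hunsat⟩ := hN₀ n hn
  have hφ : ¬ (sumEncoding 1 E).Satisfiable := fun hsat =>
    hunsat ((sumEncoding_satisfiable_iff (p := 2) (B := 1) (by norm_num) (by norm_num) E).1 hsat)
  obtain ⟨π, hπ⟩ := exists_isDepthProofOf_neg_ofCNF_of_le hφ hd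
  exact ⟨m, hm, E, π, hsupp, hexp, hunsat, hπ⟩

open Summit.PneNP.PneNP.Theses.ExpanderLinearGenerators in
/-- **Content of crux 3.** Under `LinearGeneratorDepthFregeHard`, for every `ℓ ≥ 9`, `d ≥ 30`
and `0 < δ < 1` there are `ε > 0` and `N₀` such that for every `n ≥ N₀` some depth-`d`
`textbookFrege` proof `π` of the target of an actual qualifying system on `n` variables with
`m ≤ n` rows EXISTS and has `proofSize π ≥ 2^(n^ε)`: the crux asserts a `2^(n^ε)` lower bound
for depth-`d` Frege on an existing family of XOR-CNFs of size `O(n·2^ℓ)`, one for every large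
`n` — Krajíček's Problem 19.4.5 — and is not satisfied vacuously.
[Krajíček 2019, Problem 19.4.5] [folklore] -/
theorem linearGeneratorDepthFregeHard_lift_content (h : LinearGeneratorDepthFregeHard) {ℓ d : ℕ}
    (hℓ : 9 ≤ ℓ) (hd : 30 ≤ d) {δ : ℝ} (hδ0 : 0 < δ) (hδ1 : δ < 1) :
    ∃ ε : ℝ, 0 < ε ∧ ∃ N₀ : ℕ, ∀ n : ℕ, N₀ ≤ n → ∃ m : ℕ, m ≤ n ∧
      ∃ (E : Fin m → LinEqMod 2 n) (π : List (PropForm ℕ)),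
        textbookFrege.IsDepthProofOf d π (PropForm.neg (PropForm.ofCNF (sumEncoding 1 E))) ∧
        (2 : ℝ) ^ ((n : ℝ) ^ ε) ≤ (proofSize π : ℝ) := by
  obtain ⟨ε, hε, N, hN⟩ := h ℓ d δ (by omega) hδ0 hδ1
  obtain ⟨N₀, hN₀⟩ := linearGeneratorDepthFregeHard_instances_with_proofs hℓ hd hδ0
  refine ⟨ε, hε, max N N₀, fun n hn => ?_⟩
  obtain ⟨m, hm, E, π, hsupp, hexp, hunsat, hπ⟩ := hN₀ n (le_of_max_le_right hn)
  exact ⟨m, hm, E, π, hπ, hN n (le_of_max_le_left hn) m E hsupp hexp hunsat π hπ⟩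

open Summit.PneNP.PneNP.Theses.ExpanderLinearGenerators in
/-- **Content of crux 4 (`LinearGeneratorModPFregeHard`, stmt-PneNP-11444) on the same
instances.** Under the `AC⁰[p]` rung, for every odd prime `p`, `ℓ ≥ 9`, `d ≥ 30` and
`0 < δ < 1` there are `ε > 0` and `N₀` such that for every `n ≥ N₀` some depth-`d`
`textbookFrege(MOD_p)` proof of the target of an actual qualifying system on `n` variables with
`m ≤ n` rows exists (`exists_isModDepthProofOf_sumEncoding`) and has `modProofSize ≥ 2^(n^ε)`.
[Krajíček 2019, Problem 15.6.1; Buss et al. 1997, Def. 1.1] [folklore] -/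
theorem linearGeneratorModPFregeHard_lift_content (h : LinearGeneratorModPFregeHard) {p : ℕ}
    (hp : p.Prime) (hp2 : p ≠ 2) {ℓ d : ℕ} (hℓ : 9 ≤ ℓ) (hd : 30 ≤ d) {δ : ℝ} (hδ0 : 0 < δ)
    (hδ1 : δ < 1) :
    ∃ ε : ℝ, 0 < ε ∧ ∃ N₀ : ℕ, ∀ n : ℕ, N₀ ≤ n → ∃ m : ℕ, m ≤ n ∧
      ∃ (E : Fin m → LinEqMod 2 n) (π : List (PropFormMod p ℕ)),
        textbookFrege.IsModDepthProofOf d π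
          (PropFormMod.ofPropForm (PropForm.neg (PropForm.ofCNF (sumEncoding 1 E)))) ∧
        (2 : ℝ) ^ ((n : ℝ) ^ ε) ≤ (modProofSize π : ℝ) := by
  obtain ⟨ε, hε, N, hN⟩ := h p hp hp2 ℓ d δ (by omega) hδ0 hδ1
  obtain ⟨N₀, hN₀⟩ := linearGeneratorDepthFregeHard_instances hℓ hδ0
  refine ⟨ε, hε, max N N₀, fun n hn => ?_⟩
  obtain ⟨m, hm, E, hsupp, hexp, hunsat⟩ := hN₀ n (le_of_max_le_right hn)
  obtain ⟨π, hπ⟩ := exists_isModDepthProofOf_sumEncoding p E hunsat hd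
  exact ⟨m, hm, E, π, hπ, hN n (le_of_max_le_left hn) m E hsupp hexp hunsat π hπ⟩

end Summit.PneNP.PneNP.Theorems
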